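import Summits.QuantumFields.YangMills.Theorems.UnitScaleTiltProp7ExistOfCminThm2
import Literature.MathematicalPhysics.QuantumFieldTheory.Balaban1983to89.B8Thm2TorusSupplier
import HarnessLib

/-!
# Route `UnitScaleTilt`, crux K1 child «MinimiserStabilityRegPr» (stmt-QuantumFields-19200), skeleton v10 stub EX (`stub_existenceMinimalOrbit`),
# route (α) of record `{C-min, COV}` (OWNER RULING g25-№1 §B) — **THE COV SOCKET ONE LEVEL DOWN: COV, AND EX MODULO C-min, FROM THE SOCKETS OF
# THE lit-balaban SUPPLIER OF [Balaban1985RegularSpaces] THEOREM 2 ON THE TORUS** (`B8Thm2TorusSupplier.Thm2TorusSockets` at `d = 3`, `G = SU(2)`,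
# AT THE T³ MEMBERS ONLY: Proposition 5 — existence at every level and uniqueness (1.109) —, the (1.42) clause, and the in-edge (1.59) = Theorem 3.3
# of [Balaban1985BackgroundPropagators]), BY NAME through `B8Thm2TorusSupplier.thm2TorusAt_specialUnitary_of_sockets` + `thm2TorusWindows_threshold`

Cell `ym3-torus` ∕ width seat `ym-ust-19200-w1` (gen 2; D-0149; HUMAN RULING D-0037 — YM₃ on T³ is ladder rung R3, not the Clay problem).

WHY.  `Prop7CovOfThm2.cov_of_thm2TorusAt` (p595412) hangs COV on the consumer interface `B8Thm2TorusAt.Thm2TorusAt … (specialUnitaryUnits (Fin 2))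
(fun _ => True)` at every member; the lit-balaban supplier (seat t2s-1, «B8 §3 Thm 2 TORUS SUPPLIER») proves that interface MODULO SOCKETS
(`thm2TorusAt_specialUnitary_of_sockets`: print's own architecture pp. 87–88, 94–95 — Theorem 4's induction with Proposition 5 at every step, Proposition 3
for the final norms, the uniqueness paragraph) with explicit sufficient windows and ONE threshold `c₁ > 0` depending on `d, L` and the socket constants only
(`thm2TorusWindows_threshold`).  The w1 g0 recipe (HANDOFF: «when a supplier concludes EXACTLY the hT2 binder under an extra per-(F, n, K, U₀) hypothesis,
the glue is `stub_PV3A_of_lettersAt (hLet : ∀ members …)`») is realised here at the supplier's CURRENT per-(member, `U₀`, `U′`) hypothesis, the socket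
bundle: COV — and EX given C-min — follow from the sockets AT THE T³ MEMBERS ALONE (`k = K − n ≥ 1`, `η = L^{−k}`, period `sitesPerDir 0 = 2L^{m+K}`),
with `B₁ > 1500·L·B₀` (print's `B₁ = 5dLB₀`, renamed `α₁` of (1.66): `5dLB₀(1 + 11d²)` at `d = 3`) and `c₁ = min{c₀, threshold}` UNIFORM over the members
— the uniformity COV needs (`∃ B₁ c₁` before `∀ F n K`), which `B8Thm2TorusSupplier.thm2TorusUniform_of_sockets` would give only from sockets at EVERY
`k, P, η`.  When t2s-1's layers L2e ∕ L3b ∕ L4 («route-P server `thm2TorusSockets_of_letters`», J-SU-ROADMAP.md) supply the sockets from the [B9]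
letters, EX ⇐ C-min ∧ letters is one `exact` on top of this file.

WHAT IS PROVED (sorry-free, no definition).  §1 **`thm2TorusAt_members_of_sockets`** — `∃ B₂ c₁ > 0, ∀ members, Thm2TorusAt (F.P K).L (K − n)
(sitesPerDir 0) η β₀ B₁ B₂ c₁ len SU(2) True` from the sockets at the members (windows by `thm2TorusWindows_threshold`, `B₂ := 1500·L·B₀(β₀) + 1`);
§2 **`cov_of_thm2TorusSockets`** — COV (the `hV` of `Prop7ExistRouteAlphaMin.existenceMinimalOrbit_of_Cmin_cov`, verbatim) for every `B₃ ≥ 0`;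
§3 **`existenceMinimalOrbit_of_Cmin_thm2TorusSockets`** — the registered text of `stub_existenceMinimalOrbit` at `(L, B₃)` from C-min and the sockets.

HONEST SCOPE.  COMPOSITIONS only.  The sockets — Proposition 5 of [6] (Sects. C–E, both halves), the (1.42) clause, the in-edge (1.59) = [B9] Thm 3.3
at a CURVED background — are HYPOTHESES (`hS`, displayed through `B8Thm2TorusSupplier.Thm2TorusSockets`), proved nowhere in the tree (DAG node N05 ∕ the
curved-propagator node); C-min is a hypothesis (`hC`).  So NOT a proof of COV, of the stub EX, of the crux, or of anything about the gap.  Count-neutral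
helper toward stmt-QuantumFields-19200 (`--supports`); nothing continuum ∕ OS ∕ mass-gap ∕ Clay.

References: T. Bałaban, CMP **99** (1985) 75–102 [Balaban1985RegularSpaces] (Thm 2 p.83, (1.42) p.83, (1.59) p.86, (1.65)–(1.66) p.87, Prop. 3 p.87, Thm 4
p.88, Prop. 5 (1.107)–(1.109) p.94, p.95); CMP **102** (1985) 277–309 [Balaban1985Variational] (Prop. 2 p.281, Prop. 7 p.299); CMP **96** (1984) 223–250
[Balaban1985BackgroundPropagators] (Thm 3.3 p.397).
-/

noncomputable section

open scoped Matrix.Norms.L2Operator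

namespace Summit.QuantumFields.YangMills.Theorems.Prop7CovOfThm2Sockets

open NormedSpace
open Literature.MathematicalPhysics.QuantumFieldTheory.Balaban1983to89
open Literature.MathematicalPhysics.QuantumFieldTheory.Balaban1983to89.T3ContinuumYM3Torus
open Literature.MathematicalPhysics.QuantumFieldTheory.Balaban1983to89.T3UnitLawDensityEML (ℰp)
open Literature.MathematicalPhysics.QuantumFieldTheory.Balaban1983to89.T3DescentFibreTower
open Literature.MathematicalPhysics.QuantumFieldTheory.Balaban1983to89.T3ConstrainedMinimiser
open Literature.MathematicalPhysics.QuantumFieldTheory.Balaban1983to89.T3TiltDescent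
open Literature.MathematicalPhysics.QuantumFieldTheory.Balaban1983to89.T3PrintedRegularMinimiser
open Literature.MathematicalPhysics.QuantumFieldTheory.Balaban1983to89.T3Thm1Carrier
open Literature.MathematicalPhysics.QuantumFieldTheory.Balaban1983to89.T3SectALandauChart
open B7Prop1Explicit renaming Site → LSite
open B7Prop1Explicit (e)
open B7Prop2SpecialUnitary (specialUnitaryUnits)
open B8Ineq132 (InAk)
open B8Eq119TwistedAxial (InAx)
open B8Eq133Hypotheses (Hyp135)
open B12Ineq417Flat (shiftCfg)
open B8Thm4TorusAt (torusLam)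
open B8Thm2TorusAt (Thm2TorusAt)
open B8Thm2TorusSupplier (Thm2TorusSockets thm2TorusAt_specialUnitary_of_sockets thm2TorusWindows_threshold)
open Summit.QuantumFields.YangMills.Theorems.Prop7TPrint
open Summit.QuantumFields.YangMills.Theorems.Prop7SPrint
open Summit.QuantumFields.YangMills.Theorems.Prop7CovOfThm2 (cov_of_thm2TorusAt)
open Summit.QuantumFields.YangMills.Theorems.Prop7ExistOfCminThm2 (existenceMinimalOrbit_of_Cmin_thm2TorusAt)

variable {L : ℕ}

/-! ## §1 `Thm2TorusAt` at every T³ member, with member-uniform constants, from the sockets at the members -/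

/-- **[6] THEOREM 2 ON THE TORUS AT EVERY T³ MEMBER FROM THE SOCKETS AT THE MEMBERS, CONSTANTS UNIFORM IN THE MEMBER.**  `d = 3`, `G = SU(2) ⊂ M₂(ℂ)`
(operator norm), block size `L ≥ 2`; socket constants `β₀` (Hölder exponent), `B₀, B₀(β₀)` ((1.59)), `B₄` ((1.108)), `c_u` ((1.109)), a window `c₀`, and
`B₁ > 1500·L·B₀` (print's `5dLB₀(1 + 11d²)` at `d = 3`), `15·L·B₀ ≥ 2` («B₁ not too small», p. 89).  IF at every member (`F.L = L`, `n < K`; `k = K − n`,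
`η = L^{−k}`, period `sitesPerDir 0`) and every `α₀, α₁ > 0` with `α₀ + α₁ ≤ c₀` the socket bundle `Thm2TorusSockets L k (sitesPerDir 0) η β₀ B₀ B₀β B₄ c_u
B₁ len SU(2) α₀ α₁ U₀ U′` holds for every admissible `SU(2)`-valued periodic pair `(U₀, U′)` ((1.33)–(1.35) on `ℤ³`), THEN there are `B₂, c₁ > 0` (the
SAME for all members: `B₂ = 1500·L·B₀(β₀) + 1`, `c₁ = min{c₀, threshold(d, L, B₀, B₄, c_u, B₁)}`) with `Thm2TorusAt (F.P K).L k (sitesPerDir 0) η β₀ B₁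
B₂ c₁ len SU(2) (fun _ => True)` at every member (`B8Thm2TorusSupplier.thm2TorusAt_specialUnitary_of_sockets` with the windows from
`thm2TorusWindows_threshold`).  A composition; Theorem 2 is NOT thereby proved (the sockets are hypotheses).
[cite: Balaban1985RegularSpaces, Thm 2 p.83, p.83 (sentence after (1.39)), Thm 4 p.88, p.89 («at least for B₁ not too small»), Prop. 5 p.94, p.95] -/
theorem thm2TorusAt_members_of_sockets (hL : 2 ≤ L) {β₀ B₀ B₀β B₄ cu B₁ c₀ : ℝ} {len : LSite 3 → ℝ}
    (hB₀ : 2 ≤ 15 * (L : ℝ) * B₀) (hB₀β : 0 ≤ B₀β) (hB₄ : 0 ≤ B₄) (hcu : 0 < cu) (hB₁ : 1500 * (L : ℝ) * B₀ < B₁) (hc₀ : 0 < c₀)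
    (hS : ∀ (F : T3Family), F.L = L → ∀ (n K : ℕ), n < K → ∀ ⦃α₀ α₁ : ℝ⦄, 0 < α₀ → 0 < α₁ → α₀ + α₁ ≤ c₀ →
      ∀ U₀ U' : LSite 3 → Fin 3 → (Matrix (Fin 2) (Fin 2) ℂ)ˣ,
      (∀ x κ, U₀ x κ ∈ specialUnitaryUnits (Fin 2)) → (∀ x κ, U' x κ ∈ specialUnitaryUnits (Fin 2)) →
      (∀ i : Fin 3, shiftCfg (((((F.P K).sitesPerDir 0 : ℕ) : ℤ)) • e i) U₀ = U₀) →
      (∀ i : Fin 3, shiftCfg (((((F.P K).sitesPerDir 0 : ℕ) : ℤ)) • e i) U' = U') →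
      InAk L (K - n) (eta F n K) α₀ (fun _ => (Set.univ : Set (LSite 3))) U₀ →
      InAk L (K - n) (eta F n K) α₀ (fun _ => (Set.univ : Set (LSite 3))) (U' * U₀) →
      InAx L (K - n) (torusLam (K - n)) U₀ (U' * U₀) → Hyp135 L (K - n) (torusLam (K - n)) α₁ U₀ U' →
      Thm2TorusSockets L (K - n) ((((F.P K).sitesPerDir 0 : ℕ) : ℤ)) (eta F n K) β₀ B₀ B₀β B₄ cu B₁ len
        (specialUnitaryUnits (Fin 2)) α₀ α₁ U₀ U') :
    ∃ B₂ c₁ : ℝ, 0 < B₂ ∧ 0 < c₁ ∧ ∀ (F : T3Family), F.L = L → ∀ (n K : ℕ), n < K →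
      Thm2TorusAt (F.P K).L (K - n) ((((F.P K).sitesPerDir 0 : ℕ) : ℤ)) (eta F n K) β₀ B₁ B₂ c₁ len
        (specialUnitaryUnits (Fin 2)) (fun _ => True) := by
  have hd2 : 2 ≤ (3 : ℕ) := by norm_num
  have hd1 : 1 ≤ (3 : ℕ) := by norm_num
  have hL1 : 1 ≤ L := le_trans (by norm_num) hL
  have hLr : (1 : ℝ) ≤ (L : ℝ) := by exact_mod_cast hL1
  have h15 : (5 : ℝ) * ((3 : ℕ) : ℝ) * (L : ℝ) * B₀ = 15 * (L : ℝ) * B₀ := by push_cast; ring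
  have h1500 : (5 : ℝ) * ((3 : ℕ) : ℝ) * (L : ℝ) * B₀ * (1 + 11 * ((3 : ℕ) : ℝ) ^ 2) = 1500 * (L : ℝ) * B₀ := by push_cast; ring
  have h1500β : (5 : ℝ) * ((3 : ℕ) : ℝ) * (L : ℝ) * B₀β * (1 + 11 * ((3 : ℕ) : ℝ) ^ 2) = 1500 * (L : ℝ) * B₀β := by push_cast; ring
  have hB₀d : 2 ≤ 5 * ((3 : ℕ) : ℝ) * (L : ℝ) * B₀ := by rw [h15]; exact hB₀
  have hB₀' : 0 ≤ B₀ := by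
    by_contra h
    have hneg : 15 * (L : ℝ) * B₀ < 0 := mul_neg_of_pos_of_neg (by positivity) (lt_of_not_ge h)
    linarith
  have hB₁d : 5 * ((3 : ℕ) : ℝ) * (L : ℝ) * B₀ * (1 + 11 * ((3 : ℕ) : ℝ) ^ 2) < B₁ := by rw [h1500]; exact hB₁
  have hB₁0 : 0 ≤ B₁ := by
    have : 0 ≤ 1500 * (L : ℝ) * B₀ := by positivity
    linarith
  set B₂ : ℝ := 1500 * (L : ℝ) * B₀β + 1 with hB₂
  have hB₂d : 5 * ((3 : ℕ) : ℝ) * (L : ℝ) * B₀β * (1 + 11 * ((3 : ℕ) : ℝ) ^ 2) < B₂ := by rw [h1500β, hB₂]; linarith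
  have hB₂pos : 0 < B₂ := by
    have : 0 ≤ 1500 * (L : ℝ) * B₀β := by positivity
    rw [hB₂]; linarith
  obtain ⟨c, hc, hW⟩ := thm2TorusWindows_threshold (d := 3) hd1 hL1 hB₀d hB₄ hcu hB₁0
  refine ⟨B₂, min c c₀, hB₂pos, lt_min hc hc₀, fun F hF n K hnK => ?_⟩
  have hk : 1 ≤ K - n := by omega
  subst hF
  exact thm2TorusAt_specialUnitary_of_sockets (N := 2) hd2 (eta_pos F n K) hL hk hB₀' hB₀β hB₄ hB₁d hB₂d
    (fun α₀ α₁ hα₀ hα₁ h => hW hα₀ hα₁ (h.trans (min_le_left _ _)))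
    (fun α₀ α₁ hα₀ hα₁ h => hS F rfl n K hnK hα₀ hα₁ (h.trans (min_le_right _ _)))

/-! ## §2 COV from the sockets at the members -/

/-- **COV FROM THE SOCKETS OF THEOREM 2 ON THE TORUS AT THE T³ MEMBERS** (`d = 3`, `SU(2)`; same data as §1): the criticality-free chart hypothesis COV
of route (α) — `Prop7ExistRouteAlphaMin.existenceMinimalOrbit_of_Cmin_cov`'s `hV`, verbatim — for every `B₃ ≥ 0`
(`Prop7CovOfThm2.cov_of_thm2TorusAt` ∘ `thm2TorusAt_members_of_sockets`).  The sockets remain hypotheses.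
[cite: Balaban1985RegularSpaces, Thm 2 p.83, Prop. 5 p.94, (1.42) p.83, (1.59) p.86; Balaban1985Variational, Prop. 2 p.281] -/
theorem cov_of_thm2TorusSockets (hL : 2 ≤ L) {B₃ β₀ B₀ B₀β B₄ cu B₁ c₀ : ℝ} {len : LSite 3 → ℝ} (hB₃ : 0 ≤ B₃)
    (hB₀ : 2 ≤ 15 * (L : ℝ) * B₀) (hB₀β : 0 ≤ B₀β) (hB₄ : 0 ≤ B₄) (hcu : 0 < cu) (hB₁ : 1500 * (L : ℝ) * B₀ < B₁) (hc₀ : 0 < c₀)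
    (hS : ∀ (F : T3Family), F.L = L → ∀ (n K : ℕ), n < K → ∀ ⦃α₀ α₁ : ℝ⦄, 0 < α₀ → 0 < α₁ → α₀ + α₁ ≤ c₀ →
      ∀ U₀ U' : LSite 3 → Fin 3 → (Matrix (Fin 2) (Fin 2) ℂ)ˣ,
      (∀ x κ, U₀ x κ ∈ specialUnitaryUnits (Fin 2)) → (∀ x κ, U' x κ ∈ specialUnitaryUnits (Fin 2)) →
      (∀ i : Fin 3, shiftCfg (((((F.P K).sitesPerDir 0 : ℕ) : ℤ)) • e i) U₀ = U₀) →
      (∀ i : Fin 3, shiftCfg (((((F.P K).sitesPerDir 0 : ℕ) : ℤ)) • e i) U' = U') →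
      InAk L (K - n) (eta F n K) α₀ (fun _ => (Set.univ : Set (LSite 3))) U₀ →
      InAk L (K - n) (eta F n K) α₀ (fun _ => (Set.univ : Set (LSite 3))) (U' * U₀) →
      InAx L (K - n) (torusLam (K - n)) U₀ (U' * U₀) → Hyp135 L (K - n) (torusLam (K - n)) α₁ U₀ U' →
      Thm2TorusSockets L (K - n) ((((F.P K).sitesPerDir 0 : ℕ) : ℤ)) (eta F n K) β₀ B₀ B₀β B₄ cu B₁ len
        (specialUnitaryUnits (Fin 2)) α₀ α₁ U₀ U') :
    ∃ B₁' c₁' : ℝ, 0 < B₁' ∧ 0 < c₁' ∧ ∀ (F : T3Family) (hF : F.L = L) (n K : ℕ) (hnK : n < K) (ε₀ ε₁ ε₂ : ℝ), 0 < ε₀ → 0 < ε₁ →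
        ε₀ + (L : ℝ) ^ 3 * ε₁ ≤ c₁' → B₁' * (ε₀ + (L : ℝ) ^ 3 * ε₁) ≤ ε₂ →
        ∀ (V : GaugeField (F.P n) 0 (Matrix.specialUnitaryGroup (Fin 2) ℂ)) (U₀ : GaugeField (F.P K) 0 (Matrix.specialUnitaryGroup (Fin 2) ℂ)),
          RegPr F n K ((L : ℝ) ^ 3 * B₃ * ε₁) U₀ → CloseAvg F n K hnK.le ((L : ℝ) ^ 3 * ε₁) V U₀ →
          ∀ U : GaugeField (F.P K) 0 (Matrix.specialUnitaryGroup (Fin 2) ℂ), U ∈ regFibrePr F n K hnK.le ε₀ V → IsAxialPrint F n K U₀ U →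
            ∃ (u : GaugeTransf (F.P K) 0 (Matrix.specialUnitaryGroup (Fin 2) ℂ)) (U₁ : GaugeField (F.P K) 0 (Matrix.specialUnitaryGroup (Fin 2) ℂ))
              (X : PBond (F.P K) 0 → Matrix (Fin 2) (Fin 2) ℂ),
              RestrictedPrint F n K U₀ u ∧ GaugeField.gaugeAct u (emb15 U₀ U₁) = U ∧ In19 F n K ε₂ U₀ U₁ X ∧
                AvgCondPrint F n K hnK.le V U₀ X ∧ IsLandauPrint F n K U₀ X := by
  have hB₁pos : 0 < B₁ := by
    have hL1 : (1 : ℝ) ≤ (L : ℝ) := by exact_mod_cast (le_trans (by norm_num) hL)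
    have hB₀' : 0 < B₀ := by
      by_contra h
      have : 15 * (L : ℝ) * B₀ ≤ 0 := mul_nonpos_of_nonneg_of_nonpos (by positivity) (le_of_not_gt h)
      linarith
    have : 0 < 1500 * (L : ℝ) * B₀ := by positivity
    linarith
  obtain ⟨B₂, c₁, _hB₂, hc₁, H⟩ := thm2TorusAt_members_of_sockets hL hB₀ hB₀β hB₄ hcu hB₁ hc₀ hS
  exact cov_of_thm2TorusAt hB₃ hB₁pos hc₁ fun F hF n K hnK => ⟨β₀, B₂, len, H F hF n K hnK⟩

/-! ## §3 EX at `(L, B₃)` from C-min and the sockets at the members -/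

/-- **EX ⇐ C-min ∧ THE SOCKETS OF THEOREM 2 ON THE TORUS AT THE T³ MEMBERS** (`d = 3`, `SU(2)`): at `L ≥ 2`, `B₃ > 4`, C-min (w2's `hC`, verbatim) and
the socket bundle at the members (§1's data) IMPLY the registered text of `stub_existenceMinimalOrbit` at `(L, B₃)`
(`Prop7ExistOfCminThm2.existenceMinimalOrbit_of_Cmin_thm2TorusAt` ∘ `thm2TorusAt_members_of_sockets`).  Both inputs remain hypotheses — NOT a proof of the stub.
[cite: Balaban1985Variational, Prop. 7 p.299, Prop. 2 p.281, (116) p.295; Balaban1985RegularSpaces, Thm 2 p.83, Prop. 5 p.94, (1.59) p.86] -/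
theorem existenceMinimalOrbit_of_Cmin_thm2TorusSockets (hL : 2 ≤ L) {B₃ : ℝ} (hB₃ : 4 < B₃)
    (hC : ∃ B₀ a₄ : ℝ, 0 < B₀ ∧ 0 < a₄ ∧ ∀ (i : Idx L) (ε₁ ε₄ : ℝ), 0 < ε₁ → ε₄ ≤ a₄ → 2 * B₀ * (L : ℝ) ^ 3 * B₃ * ε₁ ≤ ε₄ →
        ∀ (V : GaugeField (i.1.1.P i.1.2.1) 0 (Matrix.specialUnitaryGroup (Fin 2) ℂ)) (U₀ : GaugeField (i.1.1.P i.1.2.2) 0 (Matrix.specialUnitaryGroup (Fin 2) ℂ)),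
          PlaqSmall ε₁ V → RegPr i.1.1 i.1.2.1 i.1.2.2 ((L : ℝ) ^ 3 * B₃ * ε₁) U₀ → CloseAvg i.1.1 i.1.2.1 i.1.2.2 i.2.2.le ((L : ℝ) ^ 3 * ε₁) V U₀ →
          ∃ X : PBond (i.1.1.P i.1.2.2) 0 → Matrix (Fin 2) (Fin 2) ℂ,
            nMax19 i.1.1 i.1.2.1 i.1.2.2 U₀ X < 3 * B₀ * (L : ℝ) ^ 3 * B₃ * ε₁ ∧ (∀ b : PBond (i.1.1.P i.1.2.2) 0, (X b).IsHermitian ∧ Matrix.trace (X b) = 0) ∧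
            AvgCondPrint i.1.1 i.1.2.1 i.1.2.2 i.2.2.le V U₀ X ∧ IsLandauPrint i.1.1 i.1.2.1 i.1.2.2 U₀ X ∧
            ∀ X' : PBond (i.1.1.P i.1.2.2) 0 → Matrix (Fin 2) (Fin 2) ℂ, nMax19 i.1.1 i.1.2.1 i.1.2.2 U₀ X' < ε₄ → (∀ b : PBond (i.1.1.P i.1.2.2) 0, (X' b).IsHermitian ∧ Matrix.trace (X' b) = 0) →
              AvgCondPrint i.1.1 i.1.2.1 i.1.2.2 i.2.2.le V U₀ X' → IsLandauPrint i.1.1 i.1.2.1 i.1.2.2 U₀ X' →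
                wilsonAction4 (emb15 U₀ (expHermField X)) ≤ wilsonAction4 (emb15 U₀ (expHermField X')))
    {β₀ B₀ B₀β B₄ cu B₁ c₀ : ℝ} {len : LSite 3 → ℝ}
    (hB₀ : 2 ≤ 15 * (L : ℝ) * B₀) (hB₀β : 0 ≤ B₀β) (hB₄ : 0 ≤ B₄) (hcu : 0 < cu) (hB₁ : 1500 * (L : ℝ) * B₀ < B₁) (hc₀ : 0 < c₀)
    (hS : ∀ (F : T3Family), F.L = L → ∀ (n K : ℕ), n < K → ∀ ⦃α₀ α₁ : ℝ⦄, 0 < α₀ → 0 < α₁ → α₀ + α₁ ≤ c₀ →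
      ∀ U₀ U' : LSite 3 → Fin 3 → (Matrix (Fin 2) (Fin 2) ℂ)ˣ,
      (∀ x κ, U₀ x κ ∈ specialUnitaryUnits (Fin 2)) → (∀ x κ, U' x κ ∈ specialUnitaryUnits (Fin 2)) →
      (∀ i : Fin 3, shiftCfg (((((F.P K).sitesPerDir 0 : ℕ) : ℤ)) • e i) U₀ = U₀) →
      (∀ i : Fin 3, shiftCfg (((((F.P K).sitesPerDir 0 : ℕ) : ℤ)) • e i) U' = U') →
      InAk L (K - n) (eta F n K) α₀ (fun _ => (Set.univ : Set (LSite 3))) U₀ →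
      InAk L (K - n) (eta F n K) α₀ (fun _ => (Set.univ : Set (LSite 3))) (U' * U₀) →
      InAx L (K - n) (torusLam (K - n)) U₀ (U' * U₀) → Hyp135 L (K - n) (torusLam (K - n)) α₁ U₀ U' →
      Thm2TorusSockets L (K - n) ((((F.P K).sitesPerDir 0 : ℕ) : ℤ)) (eta F n K) β₀ B₀ B₀β B₄ cu B₁ len
        (specialUnitaryUnits (Fin 2)) α₀ α₁ U₀ U') :
    ∃ a₁' O₁ : ℝ, 0 < a₁' ∧ 1 ≤ O₁ ∧
    ∀ (F : T3Family), F.L = L → ∀ (n K : ℕ) (hnK : n < K) (ε₁ : ℝ), 0 < ε₁ →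
      ∀ V : GaugeField (F.P n) 0 (Matrix.specialUnitaryGroup (Fin 2) ℂ), PlaqSmall ε₁ V →
        ∀ U₀ : GaugeField (F.P K) 0 (Matrix.specialUnitaryGroup (Fin 2) ℂ), RegPr F n K ((L : ℝ) ^ 3 * B₃ * ε₁) U₀ → U₀ ∈ fibre F ℰp n K hnK.le V →
          ε₁ ≤ a₁' → ∃ U ∈ regFibrePr F n K hnK.le (O₁ * (L : ℝ) ^ 3 * B₃ * ε₁) V,
            IsMinOn (fun W : GaugeField (F.P K) 0 (Matrix.specialUnitaryGroup (Fin 2) ℂ) => wilsonAction4 W)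
              (regFibrePr F n K hnK.le (O₁ * (L : ℝ) ^ 3 * B₃ * ε₁) V) U := by
  have hL1 : 1 < L := lt_of_lt_of_le (by norm_num) hL
  have hB₁pos : 0 < B₁ := by
    have hL1r : (1 : ℝ) ≤ (L : ℝ) := by exact_mod_cast hL1.le
    have hB₀' : 0 < B₀ := by
      by_contra h
      have : 15 * (L : ℝ) * B₀ ≤ 0 := mul_nonpos_of_nonneg_of_nonpos (by positivity) (le_of_not_gt h)
      linarith
    have : 0 < 1500 * (L : ℝ) * B₀ := by positivity
    linarith
  obtain ⟨B₂, c₁, _hB₂, hc₁, H⟩ := thm2TorusAt_members_of_sockets hL hB₀ hB₀β hB₄ hcu hB₁ hc₀ hS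
  exact existenceMinimalOrbit_of_Cmin_thm2TorusAt hL1 hB₃ hC hB₁pos hc₁ fun F hF n K hnK => ⟨β₀, B₂, len, H F hF n K hnK⟩

end Summit.QuantumFields.YangMills.Theorems.Prop7CovOfThm2Sockets

end
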